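import Summits.FinalStateConjecture.FinalStateConjecture.Theorems.ZeroEnergyKerrOrBombStationaryLimitReductionNearZoneTransfer
import Summits.FinalStateConjecture.FinalStateConjecture.Theorems.ZeroEnergyKerrOrBombStationaryLimitReductionKerrSchildRecut
import Summits.FinalStateConjecture.FinalStateConjecture.Theorems.ZeroEnergyKerrOrBombStationaryLimitReductionRecutCoveringWave3
import HarnessLib

/-!
# Route ZeroEnergyKerrOrBomb · crux `StationaryLimitReduction` (stmt-FinalStateConjecture-10021), line
# `symplectic-dual-of-the-bomb` — stub `stub_recutCovering`, wave 3: the GROWING-RADIUS `C²` transfer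
# (clause (i) of `KerrSchildRecutCovering` at the transported radii; lemma L1 of the reduction)

Helper file (`--supports stmt-FinalStateConjecture-10021`; registered helper `recutGrowingTransfer`) of the
lead's wave-3 stub worker for `stub_recutCovering : Sig4.stub_recutCovering` (lead
prover-line-stmt-FinalStateConjecture-10021-a2-0, 2026-08-16). The fixed-radius near-zone transfer of the
recut is landed (`tendsto_truncDeviationCk_readapt`, p113031: compactness of the slab piece
`{t* = 0, r₊ ≤ r ≤ R}`); clause (i) of `KerrSchildRecutCovering` asks for GROWING radii, and the junction
(clause (ii)) needs them at a definite rate — the old certified radii transported through the Kerr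
identification, `Rᵢ(cᵢ τ − s) − W`. This file proves that transfer from the asymptotic-control clause of
`IsKerrChartedWith` (tilt, radial distortion and derivatives of orders `1–3` of `Θ` bounded far out) :

* §1 `tendsto_supCkENorm_bilinPullback_of_mapsTo` — the abstract `Cᵏ` pullback transfer along a map with
  GLOBALLY bounded derivatives of orders `1 … k+1`, for arbitrary families of sets `S i ↦ W i`
  (the tree's pointwise estimate `norm_iteratedFDeriv_bilinPullback_le`);
* §2 `norm_iteratedFDeriv_recutMap_le` — derivatives of the conjugated identification
  `recutMap Λ c₀ Θ = P ∘ Θ ∘ P⁻¹`: `‖Dʲ(P ∘ Θ ∘ P⁻¹)(x)‖ ≤ ‖Λ‖ ‖Λ⁻¹‖ʲ ‖DʲΘ(P⁻¹ x)‖`;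
* §3 `kerrChartedWith_global_bounds` — under `IsKerrChartedWith`, tilt, (one-sided) radial distortion and
  the derivatives of orders `1–3` of `Θ` are bounded on the WHOLE Kerr exterior (far out: the control
  clause; on the strip `r₊ < r < r₊ + 1`: `T`-equivariance + compactness of `{t* = 0, r₊ ≤ r ≤ r₊ + 1}`
  inside the collar region, as for `kerrChartedWith_tilt_bound`);
* §4 `recut_growing_transfer` — for MONOTONE radii `R` with
  `truncDeviationCk (moved adapted background) ψ 2 (R σ) σ → 0`, the recut chart `ψ ∘ recutMap Θ` has
  `truncDeviationCk (boosted Kerr) 2 (R (c τ − s) − W) τ → 0` for all `s, W ≥ s₀` (the recut truncated slab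
  of time `τ` is carried into the window of old truncated slabs of times `[cτ − s₀, cτ + s₀]`);
* §5 `recutGrowingTransfer : RecutGrowingTransfer` (registered; the `Prop` L1 of `…RecutCoveringWave3.lean`,
  p124506) and `stub_recutCovering_of_junction : RecutJunction → Sig4.stub_recutCovering` (registered):
  what remains of stub 1G is the junction L2 alone.

Elementary real analysis over Mathlib; no named fact, nothing restated. References: DHRT arXiv:2104.08222,
§1 (truncated slab norms); Dafermos–Luk arXiv:1710.01722, Conjecture 1 (c); Petersen 2006, Ch. 10, §3.2.
-/

-- every `Summit.FinalStateConjecture.FinalStateConjecture.…` name repeats the summit = sub-problem segment (D-0017 layout)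
set_option linter.dupNamespace false

noncomputable section

open scoped Topology ENNReal Manifold ContDiff Nat
open Set Filter Function

namespace Summit.FinalStateConjecture.FinalStateConjecture.Theorems.SymplecticDualOfTheBomb

open Literature.Geometry.Lorentzian

/-! ## §1 The abstract pullback transfer along a map with globally bounded derivatives -/

section Abstract

variable {E F : Type*} [NormedAddCommGroup E] [NormedSpace ℝ E] [NormedAddCommGroup F]
  [NormedSpace ℝ F]

/-- **`Cᵏ` convergence to zero pulls back along a map with globally bounded derivatives.** Let `θ` be
`C^{k+1}` on an open set `s` with `‖Dⁱθ‖ ≤ Θb` on `s` for `1 ≤ i ≤ k + 1`, and `B` a field of bilinear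
forms, `Cᵏ` on an open `t ⊇ θ(s)`. If `θ` maps `S i ⊆ s` into `W i` and the `Cᵏ` sup norms of `B` over
`W i` tend to `0` along `l`, then so do the `Cᵏ` sup norms of `bilinPullback θ B` over `S i` (pointwise
estimate `norm_iteratedFDeriv_bilinPullback_le`). Petersen 2006, Ch. 10, §3.2. [folklore] -/
theorem tendsto_supCkENorm_bilinPullback_of_mapsTo {ι : Type*} {l : Filter ι} {θ : E → F} {s : Set E}
    (hs : IsOpen s) {k : ℕ} (hθ : ContDiffOn ℝ (k + 1) θ s) {Θb : ℝ} (hΘ₁ : 1 ≤ Θb)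
    (hθb : ∀ x ∈ s, ∀ i, 1 ≤ i → i ≤ k + 1 → ‖iteratedFDeriv ℝ i θ x‖ ≤ Θb)
    {B : F → F →L[ℝ] F →L[ℝ] ℝ} {t : Set F} (ht : IsOpen t) (hB : ContDiffOn ℝ k B t)
    (hst : MapsTo θ s t) {S : ι → Set E} (hS : ∀ i, S i ⊆ s) {W : ι → Set F}
    (hW : ∀ i, MapsTo θ (S i) (W i)) (hlim : Tendsto (fun i ↦ supCkENorm (W i) k B) l (𝓝 0)) :
    Tendsto (fun i ↦ supCkENorm (S i) k (bilinPullback θ B)) l (𝓝 0) := by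
  set A : ℝ := 4 ^ k * k ! * Θb ^ (k + 2) with hA
  have hfin : ∀ᶠ i in l, supCkENorm (W i) k B < 1 := (tendsto_order.1 hlim).2 1 zero_lt_one
  have hN : Tendsto (fun i ↦ (supCkENorm (W i) k B).toReal) l (𝓝 0) := by
    have h := (ENNReal.tendsto_toReal ENNReal.zero_ne_top).comp hlim
    rw [ENNReal.toReal_zero] at h
    exact h
  have hupper : Tendsto (fun i ↦ ENNReal.ofReal (A * (supCkENorm (W i) k B).toReal)) l (𝓝 0) := by
    have h := ENNReal.tendsto_ofReal (hN.const_mul A)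
    simpa using h
  refine tendsto_of_tendsto_of_tendsto_of_le_of_le' tendsto_const_nhds hupper
    (Eventually.of_forall fun _ ↦ zero_le) ?_
  filter_upwards [hfin] with i hfi
  have hfin' : supCkENorm (W i) k B ≠ ⊤ := (hfi.trans ENNReal.one_lt_top).ne
  refine supCkENorm_le_ofReal fun m hm x hx ↦ ?_
  exact norm_iteratedFDeriv_bilinPullback_le hs ht hθ hB hst (hS i hx) hΘ₁ ENNReal.toReal_nonneg
    (fun j h1 hj ↦ hθb x (hS i hx) j h1 hj)
    (fun j hj ↦ norm_iteratedFDeriv_le_toReal_supCkENorm hj (hW i hx) _ hfin') hm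

end Abstract

/-! ## §2 Derivatives of the conjugated identification `P ∘ Θ ∘ P⁻¹` -/

/-- **Derivative bound for the conjugated identification.** For `Θ` of class `Cⁿ` on an open set `S`
and `P⁻¹ x ∈ S`, `1 ≤ j ≤ n`: `‖Dʲ(recutMap Λ c₀ Θ)(x)‖ ≤ ‖Λ‖ ‖Λ⁻¹‖ʲ ‖DʲΘ(P⁻¹ x)‖` (the constant `c₀`
has no derivatives of positive order, `Λ` comes out on the left, `Λ⁻¹` on the right of each slot, and the
translation by `c₀` does not change derivatives). [folklore] -/
theorem norm_iteratedFDeriv_recutMap_le (Λ : lorentzGroup) (c₀ : E4) {Θ : E4 → E4} {S : Set E4}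
    (hS : IsOpen S) {n : ℕ} (hΘ : ContDiffOn ℝ n Θ S) {x : E4} (hx : poincareInv Λ c₀ x ∈ S)
    {j : ℕ} (hj1 : 1 ≤ j) (hjn : j ≤ n) :
    ‖iteratedFDeriv ℝ j (recutMap Λ c₀ Θ) x‖ ≤
      ‖((Λ : E4 ≃L[ℝ] E4) : E4 →L[ℝ] E4)‖ * ‖((Λ : E4 ≃L[ℝ] E4).symm : E4 →L[ℝ] E4)‖ ^ j *
        ‖iteratedFDeriv ℝ j Θ (poincareInv Λ c₀ x)‖ := by
  set L : E4 ≃L[ℝ] E4 := (Λ : E4 ≃L[ℝ] E4) with hL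
  set G : E4 → E4 := Θ ∘ (L.symm : E4 → E4) with hG
  set F₁ : E4 → E4 := fun y ↦ G (y - c₀) with hF₁
  have hF₁P : ∀ y, F₁ y = Θ (poincareInv Λ c₀ y) := fun y ↦ rfl
  -- `F₁` is `Cⁿ` at `x`
  have hF₁c : ContDiffAt ℝ n F₁ x := by
    have h1 : ContDiffOn ℝ n (fun y ↦ Θ (poincareInv Λ c₀ y)) (poincareInv Λ c₀ ⁻¹' S) :=
      hΘ.comp (contDiff_poincareInv Λ c₀).contDiffOn (mapsTo_preimage _ _)
    exact h1.contDiffAt ((hS.preimage (continuous_poincareInv Λ c₀)).mem_nhds hx)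
  have hF₁j : ContDiffAt ℝ j F₁ x := hF₁c.of_le (by exact_mod_cast hjn)
  -- drop the constant `c₀`
  have hrec : recutMap Λ c₀ Θ = (fun y ↦ (L : E4 →L[ℝ] E4) (F₁ y)) + fun _ ↦ c₀ := rfl
  have hLF : ContDiffAt ℝ j (fun y ↦ (L : E4 →L[ℝ] E4) (F₁ y)) x :=
    ((L : E4 →L[ℝ] E4).contDiff.of_le le_top).contDiffAt.comp x hF₁j
  have h1 : iteratedFDeriv ℝ j (recutMap Λ c₀ Θ) x =
      iteratedFDeriv ℝ j ((L : E4 →L[ℝ] E4) ∘ F₁) x := by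
    rw [hrec, iteratedFDeriv_add_apply hLF contDiffAt_const, iteratedFDeriv_const_of_ne (by omega),
      Pi.zero_apply, add_zero]
    rfl
  -- peel `Λ` on the left
  have h2 : ‖iteratedFDeriv ℝ j ((L : E4 →L[ℝ] E4) ∘ F₁) x‖ ≤
      ‖(L : E4 →L[ℝ] E4)‖ * ‖iteratedFDeriv ℝ j F₁ x‖ :=
    (L : E4 →L[ℝ] E4).norm_iteratedFDeriv_comp_left hF₁c (by exact_mod_cast hjn)
  -- translation by `c₀`, then `Λ⁻¹` on the right
  have h3 : iteratedFDeriv ℝ j F₁ x = iteratedFDeriv ℝ j G (x - c₀) := iteratedFDeriv_comp_sub j c₀ x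
  have h4 : iteratedFDeriv ℝ j G (x - c₀) =
      (iteratedFDeriv ℝ j Θ (L.symm (x - c₀))).compContinuousLinearMap fun _ ↦ (L.symm : E4 →L[ℝ] E4) := by
    have h := L.symm.iteratedFDerivWithin_comp_right Θ uniqueDiffOn_univ (mem_univ (L.symm (x - c₀))) j
    rw [preimage_univ, iteratedFDerivWithin_univ, iteratedFDerivWithin_univ] at h
    exact h
  have h5 : ‖iteratedFDeriv ℝ j G (x - c₀)‖ ≤
      ‖iteratedFDeriv ℝ j Θ (L.symm (x - c₀))‖ * ‖(L.symm : E4 →L[ℝ] E4)‖ ^ j := by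
    rw [h4]
    refine (ContinuousMultilinearMap.norm_compContinuousLinearMap_le _ _).trans (le_of_eq ?_)
    rw [Finset.prod_const, Finset.card_univ, Fintype.card_fin]
  have hPx : L.symm (x - c₀) = poincareInv Λ c₀ x := rfl
  rw [h1]
  refine h2.trans ?_
  rw [h3, mul_assoc]
  refine mul_le_mul_of_nonneg_left ?_ (norm_nonneg _)
  rw [hPx] at h5
  linarith [h5, mul_comm (‖iteratedFDeriv ℝ j Θ (poincareInv Λ c₀ x)‖) (‖(L.symm : E4 →L[ℝ] E4)‖ ^ j)]

/-! ## §3 Global bounds for an asymptotically controlled Kerr identification -/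

/-- **Tilt, radial distortion and derivatives of a Kerr identification are bounded on the whole
exterior.** For `IsKerrChartedWith 𝓑 A M a c r₀ Θ` there is `L₁ ≥ 0` with, for every `u ∈ Kerr.exterior M a`:
`|(Θ u)⁰ − c u⁰| ≤ L₁`, `A.radius (Θ u) ≤ r(u) + L₁`, and `‖DⁿΘ u‖ ≤ L₁` for `1 ≤ n ≤ 3` (far out by the
asymptotic-control clause; on the strip `r₊ < r < r₊ + 1` by `T`-equivariance — the three quantities only
depend on the foot point `(0, y)` — and compactness of `{t* = 0, r₊ ≤ r ≤ r₊ + 1} ⊆ {r > max r₀ 0}`).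
[folklore] -/
theorem kerrChartedWith_global_bounds {𝓑 : StationaryAFBlackHole.{0}} {A : 𝓑.AdaptedChart}
    {M a c r₀ : ℝ} {Θ : E4 → E4} (h : IsKerrChartedWith 𝓑 A M a c r₀ Θ) :
    ∃ L₁ : ℝ, 0 ≤ L₁ ∧ ∀ u ∈ (Kerr.exterior M a : Set E4),
      |Θ u 0 - c * u 0| ≤ L₁ ∧ A.radius (Θ u) ≤ Kerr.radius a u + L₁ ∧
        ∀ n : ℕ, 1 ≤ n → n ≤ 3 → ‖iteratedFDeriv ℝ n Θ u‖ ≤ L₁ := by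
  obtain ⟨Lt, hLt⟩ := kerrChartedWith_tilt_bound 𝓑 A M a c r₀ Θ h
  obtain ⟨hsub, -, -, hr₀, hΘs, -, -, hΘe, -, -, L, hL⟩ := h
  have hrp : 0 < Kerr.rPlus M a := hsub.pos.trans_le (le_add_of_nonneg_right (Real.sqrt_nonneg _))
  set K : Set E4 := {x | E4.time x = 0 ∧ Kerr.rPlus M a ≤ Kerr.radius a x ∧
    Kerr.radius a x ≤ Kerr.rPlus M a + 1} with hK
  have hKc : IsCompact K := isCompact_kerrSlabPiece a hrp _
  have hKr : K ⊆ (Kerr.region a r₀ : Set E4) := kerrSlabPiece_subset_region a (max_lt hr₀ hrp) _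
  -- the spatial norm of `Θ` on `K`
  obtain ⟨Cs, hCs⟩ := hKc.exists_bound_of_continuousOn (f := fun x ↦ ‖E4.spatial (Θ x)‖)
    ((continuous_norm.comp E4.spatial.continuous).comp_continuousOn (hΘs.continuousOn.mono hKr))
  obtain ⟨CA, hCA⟩ := A.exists_abs_radius_sub_spatialNorm_le
  -- the derivatives of `Θ` on `K`
  have h3 : ((3 : ℕ) : WithTop ℕ∞) ≤ ((⊤ : ℕ∞) : WithTop ℕ∞) := WithTop.coe_le_coe.2 le_top
  have hΘ3 : ContDiffOn ℝ (3 : ℕ) Θ (Kerr.region a r₀ : Set E4) := hΘs.of_le h3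
  obtain ⟨Θ₃, hΘ₃1, hΘ₃⟩ :=
    exists_bound_iteratedFDeriv_of_isCompact (Kerr.region a r₀).isOpen (k := 2) hΘ3 hKc hKr
  have hΘ₃0 : 0 ≤ Θ₃ := zero_le_one.trans hΘ₃1
  -- equivariance in the form `Θ (x + t e₀) = Θ x + t (c e₀)`
  have hΘe' : ∀ x ∈ (Kerr.region a r₀ : Set E4), ∀ t : ℝ,
      Θ (x + t • E4.basisVector 0) = Θ x + t • (c • E4.basisVector 0) := fun x hx t ↦ by
    rw [hΘe x hx t, smul_smul, mul_comm]
  refine ⟨|Lt| + |L| + |Cs| + |CA| + Θ₃, by positivity, fun u hu ↦ ?_⟩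
  have hext : Kerr.rPlus M a < Kerr.radius a u := (le_max_left _ _).trans_lt (Kerr.mem_exterior.1 hu)
  have hreg : u ∈ (Kerr.region a r₀ : Set E4) := Kerr.mem_region.2 ((max_lt hr₀ hrp).trans hext)
  have hrad0 : 0 ≤ Kerr.radius a u := hrp.le.trans hext.le
  have h0 : 0 ≤ |Lt| + |L| + |Cs| + |CA| := by positivity
  refine ⟨(hLt u hu).trans (by linarith [le_abs_self Lt, abs_nonneg L, abs_nonneg Cs, abs_nonneg CA]),
    ?_, fun n h1 hn ↦ ?_⟩
  · by_cases hfar : Kerr.rPlus M a + 1 ≤ Kerr.radius a u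
    · have h := (abs_le.1 (hL u hu hfar).2.1).2
      linarith [le_abs_self L, abs_nonneg Lt, abs_nonneg Cs, abs_nonneg CA]
    · -- the strip: reduce to the foot point
      have hfoot : E4.ofTimeSpace 0 (E4.spatial u) ∈ K := by
        refine ⟨E4.time_ofTimeSpace 0 _, ?_, ?_⟩
        · rw [Kerr.radius_ofTimeSpace_spatial]; exact hext.le
        · rw [Kerr.radius_ofTimeSpace_spatial]; exact (not_le.1 hfar).le
      have hΘu := apply_eq_apply_foot_add (kerrRegion_add_smul_mem a r₀) hΘe hreg
      have hradeq : A.radius (Θ u) = A.radius (Θ (E4.ofTimeSpace 0 (E4.spatial u))) := by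
        rw [hΘu, adaptedRadius_add_smul_basisVector]
      have h1 := (abs_le.1 (hCA (Θ (E4.ofTimeSpace 0 (E4.spatial u))))).2
      have h2 : E4.spatialNorm (Θ (E4.ofTimeSpace 0 (E4.spatial u))) ≤ Cs := by
        have h := hCs _ hfoot
        rw [Real.norm_eq_abs, abs_norm] at h
        exact h
      rw [hradeq]
      linarith [le_abs_self Cs, le_abs_self CA, abs_nonneg Lt, abs_nonneg L]
  · by_cases hfar : Kerr.rPlus M a + 1 ≤ Kerr.radius a u
    · have hLa : L ≤ |Lt| + |L| + |Cs| + |CA| + Θ₃ := by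
        linarith [le_abs_self L, abs_nonneg Lt, abs_nonneg Cs, abs_nonneg CA]
      exact ((hL u hu hfar).2.2 n h1 hn).trans hLa
    · have hfoot : E4.ofTimeSpace 0 (E4.spatial u) ∈ K := by
        refine ⟨E4.time_ofTimeSpace 0 _, ?_, ?_⟩
        · rw [Kerr.radius_ofTimeSpace_spatial]; exact hext.le
        · rw [Kerr.radius_ofTimeSpace_spatial]; exact (not_le.1 hfar).le
      have hnN : (n : WithTop ℕ∞) ≤ ((⊤ : ℕ∞) : WithTop ℕ∞) := by exact_mod_cast le_top
      have heq := iteratedFDeriv_apply_add_smul_of_equivariant (Kerr.region a r₀).isOpen hΘe' hΘs h1 hnN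
        (hKr hfoot) (E4.time u)
      rw [ofTimeSpace_zero_spatial_add_time_smul] at heq
      rw [heq]
      exact (hΘ₃ n h1 (by omega) _ hfoot).trans (by linarith)

/-! ## §4 The growing-radius transfer -/

/-- `↑i ≤ ∞` in `WithTop ℕ∞` (cast bookkeeping for `ContDiffOn.of_le`). [folklore] -/
theorem natCast_le_infty_withTop (i : ℕ) : (i : WithTop ℕ∞) ≤ ((⊤ : ℕ∞) : WithTop ℕ∞) :=
  WithTop.coe_le_coe.2 le_top

/-- `↑i + 1 ≤ ∞` in `WithTop ℕ∞` (cast bookkeeping for `ContDiffOn.of_le`). [folklore] -/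
theorem natCast_add_one_le_infty_withTop (i : ℕ) : (i : WithTop ℕ∞) + 1 ≤ ((⊤ : ℕ∞) : WithTop ℕ∞) := by
  exact_mod_cast le_top

/-- **The growing-radius `C²` transfer of the recut** (lemma L1 of the wave-3 reduction of
`stub_recutCovering`). Let `ψ` be a smooth chart on the moved adapted domain, `Θ` a Kerr identification
with asymptotic control (`IsKerrChartedWith 𝓑 A M a c r₀ Θ`), and `R` MONOTONE radii with
`truncDeviationCk (A.background.boost Λ c₀) ψ 2 (R σ) σ → 0`. Then for all `s, W ≥ s₀` (the global bound
`L₁` of `kerrChartedWith_global_bounds`) the recut chart `ψ ∘ recutMap Λ c₀ Θ` satisfies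
`truncDeviationCk (boostedKerrBackground Λ c₀ M a) · 2 (R (c τ − s) − W) τ → 0`: the recut truncated slab
of time `τ` and radius `R (cτ − s) − W` is carried by `recutMap Θ` into the union of the old truncated slabs
of times `σ ∈ [cτ − L₁, cτ + L₁]` and radii `R σ` (tilt and radial distortion `≤ L₁`, `R` monotone), on
which the `C²` norms of the old deviation tend to `0` (`tendsto_iSup_window_of_tendsto`), and the
pullback along `recutMap Θ` (derivatives of orders `1–3` bounded by `‖Λ‖ ‖Λ⁻¹‖³ L₁`) preserves this
(`tendsto_supCkENorm_bilinPullback_of_mapsTo`, `truncDeviationCk_readapt_eq`). [folklore] -/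
theorem recut_growing_transfer (𝓢 : Spacetime.{0} 4) {𝓑 : StationaryAFBlackHole.{0}} (A : 𝓑.AdaptedChart)
    (Λ : lorentzGroup) (c₀ : E4) {M a c r₀ : ℝ} {Θ : E4 → E4}
    {ψ : (A.background.boost Λ c₀).domain → 𝓢.carrier} (hψ : ContMDiff 𝓘(ℝ, E4) (𝓡 4) ∞ ψ)
    (hW : IsKerrChartedWith 𝓑 A M a c r₀ Θ)
    (hmaps : MapsTo (recutMap Λ c₀ Θ) ((boostedKerrBackground Λ c₀ M a).domain : Set E4)
      ((A.background.boost Λ c₀).domain : Set E4))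
    {R : ℝ → ℝ} (hRmono : Monotone R)
    (hdev : Tendsto (fun σ ↦ 𝓢.truncDeviationCk (A.background.boost Λ c₀) ψ 2 (R σ) σ) atTop (𝓝 0)) :
    ∃ s₀ : ℝ, ∀ s W : ℝ, s₀ ≤ s → s₀ ≤ W →
      Tendsto (fun τ ↦ 𝓢.truncDeviationCk (boostedKerrBackground Λ c₀ M a)
        (fun y ↦ ψ ⟨recutMap Λ c₀ Θ y.1, hmaps y.2⟩) 2 (R (c * τ - s) - W) τ) atTop (𝓝 0) := by
  obtain ⟨L₁, hL₁0, hL₁⟩ := kerrChartedWith_global_bounds hW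
  obtain ⟨hsub, hc, -, hr₀, hΘs, -, hΘm, -, hiso, -, -⟩ := hW
  refine ⟨L₁, fun s W hs hWs ↦ ?_⟩
  have hψd : MDifferentiable 𝓘(ℝ, E4) (𝓡 4) ψ := hψ.mdifferentiable (by simp)
  -- the players
  set Φ : E4 → E4 := recutMap Λ c₀ Θ with hΦdef
  set B : E4 → E4 →L[ℝ] E4 →L[ℝ] ℝ := 𝓢.deviationExtend (A.background.boost Λ c₀) ψ with hBdef
  set sE : Set E4 := ((boostedKerrBackground Λ c₀ M a).domain : Set E4) with hsE
  set tE : Set E4 := poincareInv Λ c₀ ⁻¹' (A.domain : Set E4) with htE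
  have hsEo : IsOpen sE := (boostedKerrBackground Λ c₀ M a).domain.isOpen
  have htEo : IsOpen tE := A.domain.isOpen.preimage (continuous_poincareInv Λ c₀)
  have hsub' : (Kerr.exterior M a : Set E4) ⊆ (Kerr.region a r₀ : Set E4) := fun z hz ↦
    Kerr.mem_region.2 ((max_le_max hr₀.le le_rfl).trans_lt (Kerr.mem_exterior.1 hz))
  have hsEreg : sE ⊆ poincareInv Λ c₀ ⁻¹' (Kerr.region a r₀ : Set E4) := fun x hx ↦
    hsub' (mem_boostedKerrExterior.1 hx)
  have hst : MapsTo Φ sE tE := fun x hx ↦ mapsTo_conj Λ c₀ hΘm (hsEreg hx)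
  have hΘ3 : ContDiffOn ℝ (3 : ℕ) Θ (Kerr.region a r₀ : Set E4) := hΘs.of_le (natCast_le_infty_withTop 3)
  -- global derivative bound for `Φ` on the boosted exterior
  set m : ℝ := max 1 ‖((Λ : E4 ≃L[ℝ] E4).symm : E4 →L[ℝ] E4)‖ with hm
  set Θb : ℝ := max 1 (‖((Λ : E4 ≃L[ℝ] E4) : E4 →L[ℝ] E4)‖ * m ^ 3 * L₁) with hΘb
  have hθb : ∀ x ∈ sE, ∀ i, 1 ≤ i → i ≤ 2 + 1 → ‖iteratedFDeriv ℝ i Φ x‖ ≤ Θb := by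
    intro x hx i hi1 hi3
    have hz : poincareInv Λ c₀ x ∈ (Kerr.exterior M a : Set E4) := mem_boostedKerrExterior.1 hx
    have h1 := norm_iteratedFDeriv_recutMap_le Λ c₀ (Kerr.region a r₀).isOpen hΘ3 (hsub' hz) hi1
      (by omega : i ≤ 3)
    have h2 : ‖iteratedFDeriv ℝ i Θ (poincareInv Λ c₀ x)‖ ≤ L₁ := (hL₁ _ hz).2.2 i hi1 (by omega)
    have h3 : ‖((Λ : E4 ≃L[ℝ] E4).symm : E4 →L[ℝ] E4)‖ ^ i ≤ m ^ 3 :=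
      (pow_le_pow_left₀ (norm_nonneg _) (le_max_right _ _) i).trans
        (pow_le_pow_right₀ (le_max_left _ _) (by omega))
    have h4 : ‖((Λ : E4 ≃L[ℝ] E4) : E4 →L[ℝ] E4)‖ * ‖((Λ : E4 ≃L[ℝ] E4).symm : E4 →L[ℝ] E4)‖ ^ i *
        ‖iteratedFDeriv ℝ i Θ (poincareInv Λ c₀ x)‖ ≤
          ‖((Λ : E4 ≃L[ℝ] E4) : E4 →L[ℝ] E4)‖ * m ^ 3 * L₁ :=
      mul_le_mul (mul_le_mul_of_nonneg_left h3 (norm_nonneg _)) h2 (norm_nonneg _) (by positivity)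
    exact (h1.trans h4).trans (le_max_right _ _)
  -- the sets: recut truncated slabs `S τ` are carried into windows `Wt τ` of old truncated slabs
  set S : ℝ → Set E4 := fun τ ↦
    Subtype.val '' (boostedKerrBackground Λ c₀ M a).truncTimeSlab (R (c * τ - s) - W) τ with hSdef
  set g : ℝ → ℝ≥0∞ := fun σ ↦ 𝓢.truncDeviationCk (A.background.boost Λ c₀) ψ 2 (R σ) σ with hgdef
  set Wt : ℝ → Set E4 := fun τ ↦ ⋃ σ ∈ Icc (c * τ + -L₁) (c * τ + L₁),
    Subtype.val '' (A.background.boost Λ c₀).truncTimeSlab (R σ) σ with hWtdef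
  have hS : ∀ τ, S τ ⊆ sE := fun τ ↦ Subtype.coe_image_subset _ _
  have hWmaps : ∀ τ, MapsTo Φ (S τ) (Wt τ) := by
    intro τ u hu
    rw [hSdef] at hu
    simp only at hu
    rw [image_val_truncTimeSlab_boostedKerr] at hu
    obtain ⟨hu1, hu2, hu3⟩ := hu
    have hz : poincareInv Λ c₀ u ∈ (Kerr.exterior M a : Set E4) := hu1
    obtain ⟨htilt, hradial, -⟩ := hL₁ _ hz
    have hPΦ : poincareInv Λ c₀ (Φ u) = Θ (poincareInv Λ c₀ u) := poincareInv_apply_add Λ c₀ _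
    have ht1 := (abs_le.1 htilt).1
    have ht2 := (abs_le.1 htilt).2
    rw [hu2] at ht1 ht2
    refine mem_iUnion₂.2 ⟨Θ (poincareInv Λ c₀ u) 0, ⟨by linarith, by linarith⟩, ?_⟩
    rw [image_val_truncTimeSlab_boost]
    refine ⟨?_, ?_, ?_⟩
    · show poincareInv Λ c₀ (Φ u) ∈ (A.domain : Set E4)
      rw [hPΦ]
      exact hΘm (hsub' hz)
    · rw [hPΦ]
    · rw [hPΦ]
      have hR1 : R (c * τ - s) ≤ R (Θ (poincareInv Λ c₀ u) 0) := hRmono (by linarith)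
      linarith
  have hlim : Tendsto (fun τ ↦ supCkENorm (Wt τ) 2 B) atTop (𝓝 0) := by
    refine tendsto_of_tendsto_of_tendsto_of_le_of_le tendsto_const_nhds
      (tendsto_iSup_window_of_tendsto hdev hc (-L₁) L₁) (fun _ ↦ zero_le) fun τ ↦ ?_
    exact supCkENorm_le_iSup₂_of_subset_iUnion₂ Subset.rfl 2 B
  have key := tendsto_supCkENorm_bilinPullback_of_mapsTo hsEo
    (((contDiffOn_conj Λ c₀ hΘs).mono hsEreg).of_le (natCast_add_one_le_infty_withTop 2)) (le_max_left _ _)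
    hθb htEo ((contDiffOn_deviationExtend 𝓢 _ hψ (contDiffOn_boost_bilin A Λ c₀)).of_le
      (natCast_le_infty_withTop 2)) hst hS hWmaps hlim
  refine key.congr fun τ ↦ ?_
  exact (truncDeviationCk_readapt_eq 𝓢 A Λ c₀ hψd hr₀.le hΘs hΘm hiso hmaps 2 (R (c * τ - s) - W) τ).symm

/-! ## §5 The registered statements: L1 holds, and the stub reduces to the junction alone -/

/-- **Registered helper `recutGrowingTransfer`: lemma L1 of the wave-3 reduction holds** (the `Prop`
`RecutGrowingTransfer` of `…RecutCoveringWave3.lean`, by `recut_growing_transfer`). [folklore] -/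
theorem recutGrowingTransfer : RecutGrowingTransfer :=
  fun 𝓢 _ A Λ c₀ _ _ _ _ _ _ hmaps _ hψ hW hRmono hdev ↦ recut_growing_transfer 𝓢 A Λ c₀ hψ hW hmaps hRmono hdev

/-- **Registered helper `stub_recutCovering_of_junction`: the registered stub `stub_recutCovering`
(`Sig4.stub_recutCovering`) follows from the junction `RecutJunction` alone** (the reduction
`stub_recutCovering_of_transfer_of_junction` of `…RecutCoveringWave3.lean` fed with `recutGrowingTransfer`).
What remains of stub 1G is exactly `RecutJunction`: clause (ii) of the recut at the transported radii
`Rᵢ(cᵢ τ − s) − W` after a late recut time — absent from tree and print. [folklore] -/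
theorem stub_recutCovering_of_junction : RecutJunction → Sig4.stub_recutCovering :=
  stub_recutCovering_of_transfer_of_junction recutGrowingTransfer

end Summit.FinalStateConjecture.FinalStateConjecture.Theorems.SymplecticDualOfTheBomb

end
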